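import Literature.Geometry.Lorentzian.SpacetimeLocalConvergence
import HarnessLib

/-!
# Subconvergence of a subsequence of the sources is subconvergence of the sources

Bookkeeping for pointed `Cᵏ_loc` subconvergence (`SpacetimeLocalConvergence.lean`): a
`LocalSubconvergence` datum for the subsequence `(𝓢_{ρ n}, p_{ρ n})` of the sources is a datum for
`(𝓢ₙ, pₙ)` with subsequence `ρ ∘ sub` and the same exhaustion / comparison maps
(`LocalSubconvergence.ofSubseq`); the far-charts clause is carried along
(`FarChartsConverge.ofSubseq`). Used when a proof first passes to a subsequence (pigeonhole on
orientations, fast-growing times) and then extracts.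

## References
* P. Petersen, *Riemannian Geometry*, 2nd ed., GTM 171, Springer 2006, Ch. 10, §3.2. [Petersen2006]
-/

noncomputable section

open Set Filter TopologicalSpace Function
open scoped Manifold ContDiff Topology

universe u v

namespace Literature.Geometry.Lorentzian

namespace Spacetime

namespace LocalSubconvergence

variable {𝓢ₙ : ℕ → Spacetime.{u} 4} {pₙ : ∀ n, (𝓢ₙ n).carrier} {𝓤 : Spacetime.{v} 4} {u : 𝓤.carrier}
  {k : ℕ}

/-- **A datum for a subsequence of the sources is a datum for the sources** (with subsequence
`ρ ∘ sub`). [cite: Petersen2006, Ch. 10 §3.2] -/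
def ofSubseq {ρ : ℕ → ℕ} (hρ : StrictMono ρ)
    (D : LocalSubconvergence (fun n ↦ 𝓢ₙ (ρ n)) (fun n ↦ pₙ (ρ n)) 𝓤 u k) :
    LocalSubconvergence 𝓢ₙ pₙ 𝓤 u k where
  sub := ρ ∘ D.sub
  strictMono_sub := hρ.comp D.strictMono_sub
  U := D.U
  monotone_U := D.monotone_U
  mem_U := D.mem_U
  iUnion_U := D.iUnion_U
  isCompact_closure_U := D.isCompact_closure_U
  embed := D.embed
  isLocalDiffeomorphOn_embed := D.isLocalDiffeomorphOn_embed
  injOn_embed := D.injOn_embed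
  embed_basepoint := D.embed_basepoint
  isFutureDirected_mfderiv_embed := D.isFutureDirected_mfderiv_embed
  tendsto_supCkENorm := D.tendsto_supCkENorm

/-- The subsequence of `ofSubseq`. [folklore] -/
@[simp]
theorem ofSubseq_sub {ρ : ℕ → ℕ} (hρ : StrictMono ρ)
    (D : LocalSubconvergence (fun n ↦ 𝓢ₙ (ρ n)) (fun n ↦ pₙ (ρ n)) 𝓤 u k) :
    (ofSubseq hρ D).sub = ρ ∘ D.sub := rfl

/-- The comparison maps of `ofSubseq`. [folklore] -/
@[simp]
theorem ofSubseq_embed {ρ : ℕ → ℕ} (hρ : StrictMono ρ)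
    (D : LocalSubconvergence (fun n ↦ 𝓢ₙ (ρ n)) (fun n ↦ pₙ (ρ n)) 𝓤 u k) :
    (ofSubseq hρ D).embed = D.embed := rfl

/-- **The far-charts clause is carried along `ofSubseq`.** [cite: Petersen2006, Ch. 10 §3.2] -/
theorem FarChartsConverge.ofSubseq {ρ : ℕ → ℕ} (hρ : StrictMono ρ)
    {D : LocalSubconvergence (fun n ↦ 𝓢ₙ (ρ n)) (fun n ↦ pₙ (ρ n)) 𝓤 u k} {B : ModelBackground}
    {Φₙ : ∀ n, B.domain → (𝓢ₙ n).carrier} {Φ : B.domain → 𝓤.carrier}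
    (h : D.FarChartsConverge B (fun n ↦ Φₙ (ρ n)) Φ) :
    (LocalSubconvergence.ofSubseq hρ D).FarChartsConverge B Φₙ Φ where
  eventually_embed_comp_eq := h.eventually_embed_comp_eq
  tendsto_supCkENorm_deviationExtend := h.tendsto_supCkENorm_deviationExtend

end LocalSubconvergence

/-- Subconvergence of a subsequence of the sources is subconvergence of the sources. [folklore] -/
theorem SubconvergesLocallyTo.ofSubseq {𝓢ₙ : ℕ → Spacetime.{u} 4} {pₙ : ∀ n, (𝓢ₙ n).carrier}
    {𝓤 : Spacetime.{v} 4} {u : 𝓤.carrier} {k : ℕ} {ρ : ℕ → ℕ} (hρ : StrictMono ρ)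
    (h : SubconvergesLocallyTo (fun n ↦ 𝓢ₙ (ρ n)) (fun n ↦ pₙ (ρ n)) 𝓤 u k) :
    SubconvergesLocallyTo 𝓢ₙ pₙ 𝓤 u k :=
  ⟨LocalSubconvergence.ofSubseq hρ h.some⟩

/-- Subconvergence with far charts of a subsequence of the sources is subconvergence with far
charts of the sources. [folklore] -/
theorem SubconvergesLocallyWithFarChartsTo.ofSubseq {𝓢ₙ : ℕ → Spacetime.{u} 4}
    {pₙ : ∀ n, (𝓢ₙ n).carrier} {𝓤 : Spacetime.{v} 4} {u : 𝓤.carrier} {k : ℕ} {B : ModelBackground}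
    {Φₙ : ∀ n, B.domain → (𝓢ₙ n).carrier} {Φ : B.domain → 𝓤.carrier} {ρ : ℕ → ℕ} (hρ : StrictMono ρ)
    (h : SubconvergesLocallyWithFarChartsTo (fun n ↦ 𝓢ₙ (ρ n)) (fun n ↦ pₙ (ρ n)) 𝓤 u k B
      (fun n ↦ Φₙ (ρ n)) Φ) :
    SubconvergesLocallyWithFarChartsTo 𝓢ₙ pₙ 𝓤 u k B Φₙ Φ := by
  obtain ⟨D, hD⟩ := h
  exact ⟨LocalSubconvergence.ofSubseq hρ D, hD.ofSubseq hρ⟩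

end Spacetime

end Literature.Geometry.Lorentzian

end
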